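import Summits.MatrixMultiplication.MatrixMultiplication.Theorems.LieRankDesigns.Negative.Walls

/-!
# Negative lemmas for the crux `LieRankDesigns` (stmt-MatrixMultiplication-7614), part F: centralizer charging (the graded abelian no-go)

Lead-side (line `Sketch`, seat prover-line-stmt-MatrixMultiplication-7614-c3) support for the open
design stub G'' `stub_nearWallDesigns`; no theorem here asserts a Theses statement positively.

**The graded abelian no-go.**  Cohn–Umans' `|S||T||U| ≤ |G|` for TPP triples in an ABELIAN group has
a graded form that is just as cheap: if `X, Y, Z ⊆ G` (any finite group) are separated by the
functions of a LEFT-invariant subspace `J ≤ ℂ^G` — for every target `(x₀, z₀)` some `f ∈ J` has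
`f(x⁻¹ y y'⁻¹ z) = [x = x₀ ∧ y = y' ∧ z = z₀]` — and the middle DIFFERENCE `y₀ y₁⁻¹` of two elements
of `Y` commutes with every `x ∈ X`, then `x⁻¹ y₀ y⁻¹ z = (y₀ y₁⁻¹) · ((y₁⁻¹ x y₁)⁻¹ y⁻¹ z)`, so the
left translate `g ↦ f_{x₀z₀}(y₀ g)` is the indicator of the single point indexed by `(x₀, y₀, z₀)`
among the points `(y₁⁻¹ x y₁)⁻¹ y⁻¹ z`: the functions indexed by `X × (Y ∩ C_G(X) y₁) × Z` are
linearly independent in `J`.  Hence (`charge_centralizer_X`)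

  `|X| · |Y ∩ C_G(X)·y₁| · |Z| ≤ dim J`   for every `y₁`,

and symmetrically (`charge_centralizer_Z`, right-invariant `J`, differences commuting with `Z`).
Consequences for every group and every such `J` (`volume_le_finrank_of_comm_X/Z`): if `Y Y⁻¹`
commutes with `X` (or with `Z`) — in particular if `G` is abelian, or `Y` lies in one coset of the
centre, or `X ⊆ T` and `Y ⊆ T·g` for an abelian subgroup `T` — then the WHOLE volume is charged:
`|X||Y||Z| ≤ dim J` (no gain over the trivial design at all, let alone over the cubic budget); in
general `|X||Y||Z| ≤ dim J · #{cosets C_G(X)·y met by Y}`: the middle set of a graded design must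
spread over `≳ V / dim J` cosets of the centralizer of each outer set.

For the crux (`J = F_k|_G`, `dim ≤ N_k = #{M : rk M ≤ k}`; `RankSep`): `charge_centralizer_X_rankSep`,
`charge_centralizer_Z_rankSep`, `volume_le_of_comm_X`, `volume_le_of_comm_Z`,
`volume_le_of_central_differences` — every witness of G / G'' / G' (which need `V ≈ N_k^{3/2}`) has a
middle set meeting `≳ N_k^{1/2}` cosets of `C_G(X)` and of `C_G(Z)`; central fibres and commuting
middles are dead at every cell `(m, k)` and every prime.  (Recorded numerically before: "commuting
middle dead", `D-status-c1.md` L5; this is the theorem, for all groups and levels.)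
-/

set_option linter.dupNamespace false

noncomputable section

open scoped BigOperators
open Literature.RepresentationTheory.FiniteGroups

namespace Summit.MatrixMultiplication.MatrixMultiplication.Theorems.LieRankDesigns.Negative

open Summit.MatrixMultiplication.MatrixMultiplication.Theses.LevelGradedCohnUmans
open Summit.MatrixMultiplication.MatrixMultiplication.Theorems.LevelOneGL2Designs.Negative
  (levelSubmodule levelSubmodule_right_inv levelSubmodule_left_inv sep_clause_of_rankSep
    finrank_levelSubmodule_le)
open Summit.MatrixMultiplication.MatrixMultiplication.Theorems.LevelTwoBeatsCubes.Negative
  (card_add_card_le_finrank)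

/-! ## The general count (every finite group, every one-sided invariant test space) -/

section General

variable {G : Type*} [Group G] [Fintype G] [DecidableEq G]

/-- **Centralizer charging, `X`-side.**  If `X, Y, Z ⊆ G` are separated by a LEFT-invariant
subspace `J ≤ ℂ^G`, then for every `y₁` the elements `y ∈ Y` whose difference `y y₁⁻¹` commutes with
all of `X` are charged with full weight: `|X| · |{y ∈ Y : ∀ x ∈ X, (y y₁⁻¹) x = x (y y₁⁻¹)}| · |Z| ≤ dim J`
(the left translates `g ↦ f_{x₀z₀}(y₀ g)` are the indicators of single points among
`(y₁⁻¹ x y₁)⁻¹ y⁻¹ z`). -/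
theorem charge_centralizer_X (J : Submodule ℂ (G → ℂ))
    (hl : ∀ f ∈ J, ∀ h : G, (fun g => f (h * g)) ∈ J) (X Y Z : Finset G)
    (hsep : ∀ x₀ ∈ X, ∀ z₀ ∈ Z, ∃ f ∈ J, ∀ x ∈ X, ∀ y ∈ Y, ∀ y' ∈ Y, ∀ z ∈ Z,
      (x = x₀ ∧ y = y' ∧ z = z₀ → f (x⁻¹ * y * y'⁻¹ * z) = 1) ∧
      (¬ (x = x₀ ∧ y = y' ∧ z = z₀) → f (x⁻¹ * y * y'⁻¹ * z) = 0))
    (y₁ : G) :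
    X.card * (Y.filter fun y => ∀ x ∈ X, y * y₁⁻¹ * x = x * (y * y₁⁻¹)).card * Z.card ≤
      Module.finrank ℂ J := by
  classical
  set Y₁ := Y.filter fun y => ∀ x ∈ X, y * y₁⁻¹ * x = x * (y * y₁⁻¹) with hY₁
  have h := card_add_card_le_finrank (A := ↥((X ×ˢ Y₁) ×ˢ Z)) (S := PEmpty.{1}) J
    (fun a => (y₁⁻¹ * a.1.1.1 * y₁)⁻¹ * a.1.1.2⁻¹ * a.1.2) (fun s => s.elim) ?_ (fun s => s.elim)
  · simpa only [Fintype.card_coe, Finset.card_product, Fintype.card_ofIsEmpty, add_zero] using h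
  rintro ⟨⟨⟨x₀, y₀⟩, z₀⟩, h₀⟩
  simp only [Finset.mem_product, hY₁, Finset.mem_filter] at h₀
  obtain ⟨⟨hx₀, hy₀, hc₀⟩, hz₀⟩ := h₀
  obtain ⟨f, hf, hspec⟩ := hsep x₀ hx₀ z₀ hz₀
  refine ⟨fun g => f (y₀ * g), hl f hf y₀, ?_, ?_, fun s => s.elim⟩
  · have e : y₀ * ((y₁⁻¹ * x₀ * y₁)⁻¹ * y₀⁻¹ * z₀) = x₀⁻¹ * y₀ * y₀⁻¹ * z₀ := by
      calc y₀ * ((y₁⁻¹ * x₀ * y₁)⁻¹ * y₀⁻¹ * z₀)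
          = x₀⁻¹ * (x₀ * (y₀ * y₁⁻¹)) * x₀⁻¹ * y₁ * y₀⁻¹ * z₀ := by group
        _ = x₀⁻¹ * (y₀ * y₁⁻¹ * x₀) * x₀⁻¹ * y₁ * y₀⁻¹ * z₀ := by rw [hc₀ x₀ hx₀]
        _ = x₀⁻¹ * y₀ * y₀⁻¹ * z₀ := by group
    show f (y₀ * ((y₁⁻¹ * x₀ * y₁)⁻¹ * y₀⁻¹ * z₀)) = 1
    rw [e]
    exact (hspec x₀ hx₀ y₀ hy₀ y₀ hy₀ z₀ hz₀).1 ⟨rfl, rfl, rfl⟩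
  · rintro ⟨⟨⟨x, y⟩, z⟩, hxyz⟩ hne
    simp only [Finset.mem_product, hY₁, Finset.mem_filter] at hxyz
    obtain ⟨⟨hx, hy, -⟩, hz⟩ := hxyz
    have e : y₀ * ((y₁⁻¹ * x * y₁)⁻¹ * y⁻¹ * z) = x⁻¹ * y₀ * y⁻¹ * z := by
      calc y₀ * ((y₁⁻¹ * x * y₁)⁻¹ * y⁻¹ * z)
          = x⁻¹ * (x * (y₀ * y₁⁻¹)) * x⁻¹ * y₁ * y⁻¹ * z := by group
        _ = x⁻¹ * (y₀ * y₁⁻¹ * x) * x⁻¹ * y₁ * y⁻¹ * z := by rw [hc₀ x hx]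
        _ = x⁻¹ * y₀ * y⁻¹ * z := by group
    show f (y₀ * ((y₁⁻¹ * x * y₁)⁻¹ * y⁻¹ * z)) = 0
    rw [e]
    refine (hspec x hx y₀ hy₀ y hy z hz).2 ?_
    rintro ⟨rfl, rfl, rfl⟩
    exact hne rfl

/-- **Centralizer charging, `Z`-side.**  If `X, Y, Z ⊆ G` are separated by a RIGHT-invariant
subspace `J ≤ ℂ^G`, then for every `y₁`:
`|X| · |{y ∈ Y : ∀ z ∈ Z, (y y₁⁻¹) z = z (y y₁⁻¹)}| · |Z| ≤ dim J`
(the right translates `g ↦ f_{x₀z₀}(g y₀⁻¹)` are the indicators of single points among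
`x⁻¹ y (y₁⁻¹ z y₁)`). -/
theorem charge_centralizer_Z (J : Submodule ℂ (G → ℂ))
    (hr : ∀ f ∈ J, ∀ h : G, (fun g => f (g * h)) ∈ J) (X Y Z : Finset G)
    (hsep : ∀ x₀ ∈ X, ∀ z₀ ∈ Z, ∃ f ∈ J, ∀ x ∈ X, ∀ y ∈ Y, ∀ y' ∈ Y, ∀ z ∈ Z,
      (x = x₀ ∧ y = y' ∧ z = z₀ → f (x⁻¹ * y * y'⁻¹ * z) = 1) ∧
      (¬ (x = x₀ ∧ y = y' ∧ z = z₀) → f (x⁻¹ * y * y'⁻¹ * z) = 0))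
    (y₁ : G) :
    X.card * (Y.filter fun y => ∀ z ∈ Z, y * y₁⁻¹ * z = z * (y * y₁⁻¹)).card * Z.card ≤
      Module.finrank ℂ J := by
  classical
  set Y₁ := Y.filter fun y => ∀ z ∈ Z, y * y₁⁻¹ * z = z * (y * y₁⁻¹) with hY₁
  have h := card_add_card_le_finrank (A := ↥((X ×ˢ Y₁) ×ˢ Z)) (S := PEmpty.{1}) J
    (fun a => a.1.1.1⁻¹ * a.1.1.2 * (y₁⁻¹ * a.1.2 * y₁)) (fun s => s.elim) ?_ (fun s => s.elim)
  · simpa only [Fintype.card_coe, Finset.card_product, Fintype.card_ofIsEmpty, add_zero] using h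
  rintro ⟨⟨⟨x₀, y₀⟩, z₀⟩, h₀⟩
  simp only [Finset.mem_product, hY₁, Finset.mem_filter] at h₀
  obtain ⟨⟨hx₀, hy₀, hc₀⟩, hz₀⟩ := h₀
  obtain ⟨f, hf, hspec⟩ := hsep x₀ hx₀ z₀ hz₀
  refine ⟨fun g => f (g * y₀⁻¹), hr f hf y₀⁻¹, ?_, ?_, fun s => s.elim⟩
  · have e : x₀⁻¹ * y₀ * (y₁⁻¹ * z₀ * y₁) * y₀⁻¹ = x₀⁻¹ * y₀ * y₀⁻¹ * z₀ := by
      calc x₀⁻¹ * y₀ * (y₁⁻¹ * z₀ * y₁) * y₀⁻¹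
          = x₀⁻¹ * y₀ * y₀⁻¹ * (y₀ * y₁⁻¹ * z₀) * y₁ * y₀⁻¹ := by group
        _ = x₀⁻¹ * y₀ * y₀⁻¹ * (z₀ * (y₀ * y₁⁻¹)) * y₁ * y₀⁻¹ := by rw [hc₀ z₀ hz₀]
        _ = x₀⁻¹ * y₀ * y₀⁻¹ * z₀ := by group
    show f (x₀⁻¹ * y₀ * (y₁⁻¹ * z₀ * y₁) * y₀⁻¹) = 1
    rw [e]
    exact (hspec x₀ hx₀ y₀ hy₀ y₀ hy₀ z₀ hz₀).1 ⟨rfl, rfl, rfl⟩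
  · rintro ⟨⟨⟨x, y⟩, z⟩, hxyz⟩ hne
    simp only [Finset.mem_product, hY₁, Finset.mem_filter] at hxyz
    obtain ⟨⟨hx, hy, -⟩, hz⟩ := hxyz
    have e : x⁻¹ * y * (y₁⁻¹ * z * y₁) * y₀⁻¹ = x⁻¹ * y * y₀⁻¹ * z := by
      calc x⁻¹ * y * (y₁⁻¹ * z * y₁) * y₀⁻¹
          = x⁻¹ * y * y₀⁻¹ * (y₀ * y₁⁻¹ * z) * y₁ * y₀⁻¹ := by group
        _ = x⁻¹ * y * y₀⁻¹ * (z * (y₀ * y₁⁻¹)) * y₁ * y₀⁻¹ := by rw [hc₀ z hz]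
        _ = x⁻¹ * y * y₀⁻¹ * z := by group
    show f (x⁻¹ * y * (y₁⁻¹ * z * y₁) * y₀⁻¹) = 0
    rw [e]
    refine (hspec x hx y hy y₀ hy₀ z hz).2 ?_
    rintro ⟨rfl, rfl, rfl⟩
    exact hne rfl

/-- **The graded abelian no-go, `X`-form.**  If the middle differences commute with the first set
(`(y y'⁻¹) x = x (y y'⁻¹)` for `y, y' ∈ Y`, `x ∈ X`) then a triple separated by a left-invariant `J`
has `|X||Y||Z| ≤ dim J`.  In an abelian group this is every triple: the graded Cohn–Umans bound. -/
theorem volume_le_finrank_of_comm_X (J : Submodule ℂ (G → ℂ))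
    (hl : ∀ f ∈ J, ∀ h : G, (fun g => f (h * g)) ∈ J) (X Y Z : Finset G)
    (hsep : ∀ x₀ ∈ X, ∀ z₀ ∈ Z, ∃ f ∈ J, ∀ x ∈ X, ∀ y ∈ Y, ∀ y' ∈ Y, ∀ z ∈ Z,
      (x = x₀ ∧ y = y' ∧ z = z₀ → f (x⁻¹ * y * y'⁻¹ * z) = 1) ∧
      (¬ (x = x₀ ∧ y = y' ∧ z = z₀) → f (x⁻¹ * y * y'⁻¹ * z) = 0))
    (hcomm : ∀ y ∈ Y, ∀ y' ∈ Y, ∀ x ∈ X, y * y'⁻¹ * x = x * (y * y'⁻¹)) :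
    X.card * Y.card * Z.card ≤ Module.finrank ℂ J := by
  classical
  obtain hY | ⟨y₁, hy₁⟩ := Y.eq_empty_or_nonempty
  · simp [hY]
  have hfilter : (Y.filter fun y => ∀ x ∈ X, y * y₁⁻¹ * x = x * (y * y₁⁻¹)) = Y :=
    Finset.filter_true_of_mem fun y hy x hx => hcomm y hy y₁ hy₁ x hx
  have h := charge_centralizer_X J hl X Y Z hsep y₁
  rwa [hfilter] at h

/-- **The graded abelian no-go, `Z`-form.**  If the middle differences commute with the third set
then a triple separated by a right-invariant `J` has `|X||Y||Z| ≤ dim J`. -/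
theorem volume_le_finrank_of_comm_Z (J : Submodule ℂ (G → ℂ))
    (hr : ∀ f ∈ J, ∀ h : G, (fun g => f (g * h)) ∈ J) (X Y Z : Finset G)
    (hsep : ∀ x₀ ∈ X, ∀ z₀ ∈ Z, ∃ f ∈ J, ∀ x ∈ X, ∀ y ∈ Y, ∀ y' ∈ Y, ∀ z ∈ Z,
      (x = x₀ ∧ y = y' ∧ z = z₀ → f (x⁻¹ * y * y'⁻¹ * z) = 1) ∧
      (¬ (x = x₀ ∧ y = y' ∧ z = z₀) → f (x⁻¹ * y * y'⁻¹ * z) = 0))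
    (hcomm : ∀ y ∈ Y, ∀ y' ∈ Y, ∀ z ∈ Z, y * y'⁻¹ * z = z * (y * y'⁻¹)) :
    X.card * Y.card * Z.card ≤ Module.finrank ℂ J := by
  classical
  obtain hY | ⟨y₁, hy₁⟩ := Y.eq_empty_or_nonempty
  · simp [hY]
  have hfilter : (Y.filter fun y => ∀ z ∈ Z, y * y₁⁻¹ * z = z * (y * y₁⁻¹)) = Y :=
    Finset.filter_true_of_mem fun y hy z hz => hcomm y hy y₁ hy₁ z hz
  have h := charge_centralizer_Z J hr X Y Z hsep y₁
  rwa [hfilter] at h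

end General

/-! ## The crux: `J = F_k|_G`, `G = GL_m(𝔽_p)`, `dim J ≤ N_k` -/

section Crux

variable {p m : ℕ} [Fact p.Prime] {k : ℕ} {X Y Z : Finset (GLm p m)}

/-- **Centralizer charging for the crux, `X`-side**: for an `F_k`-separated triple and any `y₁`,
`|X| · |{y ∈ Y : y y₁⁻¹ ∈ C(X)}| · |Z| ≤ N_k`. -/
theorem charge_centralizer_X_rankSep (hsep : RankSep k X Y Z) (y₁ : GLm p m) :
    X.card * (Y.filter fun y => ∀ x ∈ X, y * y₁⁻¹ * x = x * (y * y₁⁻¹)).card * Z.card ≤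
      Fintype.card ({M : Mat p m // M.rank ≤ k}) :=
  (charge_centralizer_X (levelSubmodule p m k) levelSubmodule_left_inv X Y Z
    (sep_clause_of_rankSep hsep) y₁).trans finrank_levelSubmodule_le

/-- **Centralizer charging for the crux, `Z`-side**: for an `F_k`-separated triple and any `y₁`,
`|X| · |{y ∈ Y : y y₁⁻¹ ∈ C(Z)}| · |Z| ≤ N_k`. -/
theorem charge_centralizer_Z_rankSep (hsep : RankSep k X Y Z) (y₁ : GLm p m) :
    X.card * (Y.filter fun y => ∀ z ∈ Z, y * y₁⁻¹ * z = z * (y * y₁⁻¹)).card * Z.card ≤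
      Fintype.card ({M : Mat p m // M.rank ≤ k}) :=
  (charge_centralizer_Z (levelSubmodule p m k) levelSubmodule_right_inv X Y Z
    (sep_clause_of_rankSep hsep) y₁).trans finrank_levelSubmodule_le

/-- **Commuting middle is dead, `X`-form**: if `Y Y⁻¹` commutes with `X` then `|X||Y||Z| ≤ N_k` —
the whole volume of the design is charged (so it proves nothing beyond the trivial design). -/
theorem volume_le_of_comm_X (hsep : RankSep k X Y Z)
    (hcomm : ∀ y ∈ Y, ∀ y' ∈ Y, ∀ x ∈ X, y * y'⁻¹ * x = x * (y * y'⁻¹)) :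
    X.card * Y.card * Z.card ≤ Fintype.card ({M : Mat p m // M.rank ≤ k}) :=
  (volume_le_finrank_of_comm_X (levelSubmodule p m k) levelSubmodule_left_inv X Y Z
    (sep_clause_of_rankSep hsep) hcomm).trans finrank_levelSubmodule_le

/-- **Commuting middle is dead, `Z`-form**: if `Y Y⁻¹` commutes with `Z` then `|X||Y||Z| ≤ N_k`. -/
theorem volume_le_of_comm_Z (hsep : RankSep k X Y Z)
    (hcomm : ∀ y ∈ Y, ∀ y' ∈ Y, ∀ z ∈ Z, y * y'⁻¹ * z = z * (y * y'⁻¹)) :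
    X.card * Y.card * Z.card ≤ Fintype.card ({M : Mat p m // M.rank ≤ k}) :=
  (volume_le_finrank_of_comm_Z (levelSubmodule p m k) levelSubmodule_right_inv X Y Z
    (sep_clause_of_rankSep hsep) hcomm).trans finrank_levelSubmodule_le

/-- **Central fibres are dead**: if all middle differences `y y'⁻¹` are central (e.g. `Y` inside one
coset of the centre `𝔽_p^× · 1`), then `|X||Y||Z| ≤ N_k`. -/
theorem volume_le_of_central_differences (hsep : RankSep k X Y Z)
    (hcen : ∀ y ∈ Y, ∀ y' ∈ Y, y * y'⁻¹ ∈ Subgroup.center (GLm p m)) :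
    X.card * Y.card * Z.card ≤ Fintype.card ({M : Mat p m // M.rank ≤ k}) :=
  volume_le_of_comm_X hsep fun y hy y' hy' x _ =>
    ((Subgroup.mem_center_iff.1 (hcen y hy y' hy')) x).symm

end Crux

end Summit.MatrixMultiplication.MatrixMultiplication.Theorems.LieRankDesigns.Negative

end
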